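import Mathlib
import Summits.Ventures.PercRepro.PuncturedLYMUnif55Table
import Summits.Ventures.PercRepro.PuncturedLYMUnif55Cols1

/-!
# PercRepro — (SP) FOR ANY NUMBER OF PAIRWISE DISJOINT `5`-SETS AT LEVEL `5`: THE COLUMN IDENTITIES, ASSEMBLED
(p10, gen 41)

`col_check`: the column identity of every free column class with `Σ v d_v ≤ 6`, by nested `interval_cases` over the class counts (only the feasible classes are enumerated).  Nothing here asserts (SP).
-/

namespace PercRepro.PuncturedLYM.Split.TypeLift.Unif55

/-- The column identity of every free column class, in one statement. -/
theorem col_check (n k : ℚ) (hQ : Qp n k ≠ 0) (hP : Pp n k ≠ 0) (d1 d2 d3 d4 : ℕ)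
    (h : d1 + 2 * d2 + 3 * d3 + 4 * d4 ≤ 6) :
    1 * (d1 : ℚ) * raw n k (d1 - 1) d2 d3 d4 0 + 2 * (d2 : ℚ) * raw n k (d1 + 1) (d2 - 1) d3 d4 1 + 3 * (d3 : ℚ) * raw n k d1 (d2 + 1) (d3 - 1) d4 2 + 4 * (d4 : ℚ) * raw n k d1 d2 (d3 + 1) (d4 - 1) 3 +
      ((6 : ℚ) - d1 - 2 * d2 - 3 * d3 - 4 * d4) * raw n k d1 d2 d3 d4 5 = 1 := by
  have hb4 : d4 ≤ 1 := by omega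
  interval_cases d4
  · have hb3 : d3 ≤ 2 := by omega
    interval_cases d3
    · have hb2 : d2 ≤ 3 := by omega
      interval_cases d2
      · have hb1 : d1 ≤ 6 := by omega
        interval_cases d1
        · push_cast
          linear_combination col_0000 n k hQ hP
        · push_cast
          linear_combination col_1000 n k hQ hP
        · push_cast
          linear_combination col_2000 n k hQ hP
        · push_cast
          linear_combination col_3000 n k hQ hP
        · push_cast
          linear_combination col_4000 n k hQ hP
        · push_cast
          linear_combination col_5000 n k hQ hP
        · push_cast
          linear_combination col_6000 n k hQ hP
      · have hb1 : d1 ≤ 4 := by omega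
        interval_cases d1
        · push_cast
          linear_combination col_0100 n k hQ hP
        · push_cast
          linear_combination col_1100 n k hQ hP
        · push_cast
          linear_combination col_2100 n k hQ hP
        · push_cast
          linear_combination col_3100 n k hQ hP
        · push_cast
          linear_combination col_4100 n k hQ hP
      · have hb1 : d1 ≤ 2 := by omega
        interval_cases d1
        · push_cast
          linear_combination col_0200 n k hQ hP
        · push_cast
          linear_combination col_1200 n k hQ hP
        · push_cast
          linear_combination col_2200 n k hQ hP
      · have hb1 : d1 ≤ 0 := by omega
        interval_cases d1
        · push_cast
          linear_combination col_0300 n k hQ hP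
    · have hb2 : d2 ≤ 1 := by omega
      interval_cases d2
      · have hb1 : d1 ≤ 3 := by omega
        interval_cases d1
        · push_cast
          linear_combination col_0010 n k hQ hP
        · push_cast
          linear_combination col_1010 n k hQ hP
        · push_cast
          linear_combination col_2010 n k hQ hP
        · push_cast
          linear_combination col_3010 n k hQ hP
      · have hb1 : d1 ≤ 1 := by omega
        interval_cases d1
        · push_cast
          linear_combination col_0110 n k hQ hP
        · push_cast
          linear_combination col_1110 n k hQ hP
    · have hb2 : d2 ≤ 0 := by omega
      interval_cases d2
      · have hb1 : d1 ≤ 0 := by omega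
        interval_cases d1
        · push_cast
          linear_combination col_0020 n k hQ hP
  · have hb3 : d3 ≤ 0 := by omega
    interval_cases d3
    · have hb2 : d2 ≤ 1 := by omega
      interval_cases d2
      · have hb1 : d1 ≤ 2 := by omega
        interval_cases d1
        · push_cast
          linear_combination col_0001 n k hQ hP
        · push_cast
          linear_combination col_1001 n k hQ hP
        · push_cast
          linear_combination col_2001 n k hQ hP
      · have hb1 : d1 ≤ 0 := by omega
        interval_cases d1
        · push_cast
          linear_combination col_0101 n k hQ hP

end PercRepro.PuncturedLYM.Split.TypeLift.Unif55
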